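import Summits.NavierStokesRegularity.NavierStokesRegularity.Theorems.GaldiLiouvilleGateRecordZoomAncientStubCutoffEnstrophy
import Literature.Analysis.FluidPDE.PoincareBall
import HarnessLib

/-!
# Route `GaldiLiouvilleGate`, crux `RecordZoomAncient` (stmt-NavierStokesRegularity-0894),
  line `registered` (birth skeleton, reshape r8) — stub `stub_cutoffEnstrophyPoincare`

**Statement.** There is a constant `c > 0` such that: if `C¹` fields `f n : ℝ³ → ℝ³` with
`‖f n‖ ≤ 1` converge pointwise to a `C¹` field `fl`, and for every radius `R > 0`, eventually in
`n`, `∫_{B(0,R)} |∇f n|² ≤ D` (`D ≥ 0`), then the limit has finite GLOBAL Dirichlet energy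
`∫ |∇fl|² ≤ c D`. Compared with `stub_cutoffEnstrophy` (reshape r7) there is no local `L⁶`
input: the cut-off error is controlled by the Poincaré inequality on balls.

**Proof (cut-off of the mean-corrected fields, Poincaré, lower semicontinuity, exhaustion).**
Let `χ_R = χ(·/R)` be the tree's smooth cut-off (`Literature.Analysis.FluidPDE.cutoff R`: `= 1`
on `B̄(0,R)`, supported in `B̄(0,2R)`, values in `[0,1]`, `‖∇χ_R‖ ≤ c'/R`,
`exists_norm_fderiv_cutoff_le`), `B = B(0,3R)`, and, with `N` from the eventual hypothesis at
radius `3R`, `a_k = ⨍_B f (k + N)`, `a_∞ = ⨍_B fl` (Bochner averages; `‖a_k‖ ≤ 1`, and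
`a_k → a_∞` by dominated convergence). The `C¹` fields `g_k = χ_R (f (k + N) − a_k)` are bounded
by `2` and converge pointwise to `g_∞ = χ_R (fl − a_∞)`. By the r7 helper
`cutoffEnstrophy_lintegral_fderiv_smul_le` (Leibniz),
`∫ |∇g_k|² ≤ 2 ∫_B |∇f (k + N)|² + 6 (c'/R)² ∫_B ‖f (k + N) − a_k‖²`, and by the POINCARÉ
inequality on the ball `B` (`PoincareBall.lintegral_ball_sub_average_sq_le`, dimension `3`,
radius `3R`; the operator norm of `∇f` is dominated by its Frobenius norm)
`∫_B ‖f (k + N) − a_k‖² ≤ 2³ · 4 (3R)² ∫_B |∇f (k + N)|² ≤ 288 R² D`: the powers of `R` cancel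
and `∫ |∇g_k|² ≤ (2 + 1728 c'²) D =: c D` for all `k`. The tree's lower semicontinuity lemma
`lintegral_frobeniusNormSq_fderiv_le_of_tendsto_of_bound` transfers the bound to
`∫ |∇g_∞|² ≥ ∫_{B(0,R)} |∇fl|²` (`χ_R = 1` on the open ball and `∇(fl − a_∞) = ∇fl`). Finally
`∫ |∇fl|² = sup_n ∫_{B(0,n+1)} |∇fl|²` (`cutoffEnstrophy_lintegral_eq_iSup_ball`).
-/

noncomputable section

open Set MeasureTheory Filter Topology Function Literature.Analysis.FluidPDE
open scoped ENNReal NNReal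

namespace Summit.NavierStokesRegularity.NavierStokesRegularity.Theorems.RecordZoomAncient.Birth

-- the problem-side namespace `Summit.NavierStokesRegularity.NavierStokesRegularity.…` (summit =
-- problem for this single-problem summit) duplicates `NavierStokesRegularity` by design
set_option linter.dupNamespace false

/-- **Poincaré on the ball `B(0,3R)` with the Frobenius enstrophy density**:
`∫_B ‖g − ⨍_B g‖² ≤ 288 R² ∫_B |∇g|²` for a `C¹` field `g : ℝ³ → ℝ³`
(`2³ · 4 (3R)² = 288 R²`; the operator norm is dominated by the Frobenius norm,
`sq_opNorm_le_frobeniusNormSq`). -/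
theorem cutoffEnstrophyPoincare_lintegral_sub_average_sq_le {R : ℝ} (hR : 0 < R)
    {g : EuclideanSpace ℝ (Fin 3) → EuclideanSpace ℝ (Fin 3)} (hg : ContDiff ℝ 1 g) :
    ∫⁻ x in Metric.ball (0 : EuclideanSpace ℝ (Fin 3)) (3 * R),
        ‖g x - ⨍ y in Metric.ball (0 : EuclideanSpace ℝ (Fin 3)) (3 * R), g y‖ₑ ^ 2 ≤
      ENNReal.ofReal (288 * R ^ 2) *
        ∫⁻ x in Metric.ball (0 : EuclideanSpace ℝ (Fin 3)) (3 * R),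
          ENNReal.ofReal (frobeniusNormSq (fderiv ℝ g x)) := by
  have h3R : (0 : ℝ) < 3 * R := by positivity
  have h := PoincareBall.lintegral_ball_sub_average_sq_le hg (0 : EuclideanSpace ℝ (Fin 3)) h3R
  rw [finrank_euclideanSpace_fin] at h
  have h8 : (2 : ℝ≥0∞) ^ 3 * ENNReal.ofReal (4 * (3 * R) ^ 2) = ENNReal.ofReal (288 * R ^ 2) := by
    rw [← ENNReal.ofReal_ofNat 2, ← ENNReal.ofReal_pow zero_le_two,
      ← ENNReal.ofReal_mul (by positivity)]
    congr 1
    ring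
  calc ∫⁻ x in Metric.ball (0 : EuclideanSpace ℝ (Fin 3)) (3 * R),
        ‖g x - ⨍ y in Metric.ball (0 : EuclideanSpace ℝ (Fin 3)) (3 * R), g y‖ₑ ^ 2
      ≤ 2 ^ 3 * ENNReal.ofReal (4 * (3 * R) ^ 2) *
          ∫⁻ x in Metric.ball (0 : EuclideanSpace ℝ (Fin 3)) (3 * R), ‖fderiv ℝ g x‖ₑ ^ 2 := h
    _ ≤ 2 ^ 3 * ENNReal.ofReal (4 * (3 * R) ^ 2) *
          ∫⁻ x in Metric.ball (0 : EuclideanSpace ℝ (Fin 3)) (3 * R),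
            ENNReal.ofReal (frobeniusNormSq (fderiv ℝ g x)) := by
        gcongr with x
        rw [← ofReal_norm, ← ENNReal.ofReal_pow (norm_nonneg _)]
        exact ENNReal.ofReal_le_ofReal (sq_opNorm_le_frobeniusNormSq _)
    _ = _ := by rw [h8]

/-- The Bochner average over a set of finite measure of a field bounded by `K ≥ 0` has norm
`≤ K`. -/
theorem cutoffEnstrophyPoincare_norm_setAverage_le {s : Set (EuclideanSpace ℝ (Fin 3))}
    (hs : volume s < ∞) {g : EuclideanSpace ℝ (Fin 3) → EuclideanSpace ℝ (Fin 3)} {K : ℝ}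
    (hK0 : 0 ≤ K) (hK : ∀ x, ‖g x‖ ≤ K) : ‖⨍ y in s, g y‖ ≤ K := by
  rw [setAverage_eq, norm_smul, norm_inv, Real.norm_of_nonneg measureReal_nonneg]
  rcases eq_or_ne (volume.real s) 0 with h | h
  · rw [h, inv_zero, zero_mul]
    exact hK0
  · rw [inv_mul_le_iff₀' (measureReal_nonneg.lt_of_ne' h)]
    exact norm_setIntegral_le_of_norm_le_const hs fun x _ => hK x

/-- **Dominated convergence of the averages.** If continuous fields `f n`, bounded by `1`,
converge pointwise to `fl`, then `⨍_s f n → ⨍_s fl` for every set `s` of finite measure. -/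
theorem cutoffEnstrophyPoincare_tendsto_setAverage {s : Set (EuclideanSpace ℝ (Fin 3))}
    (hs : volume s ≠ ∞) {f : ℕ → EuclideanSpace ℝ (Fin 3) → EuclideanSpace ℝ (Fin 3)}
    {fl : EuclideanSpace ℝ (Fin 3) → EuclideanSpace ℝ (Fin 3)} (hf : ∀ n, Continuous (f n))
    (hbd : ∀ n x, ‖f n x‖ ≤ 1) (hconv : ∀ x, Tendsto (fun n => f n x) atTop (𝓝 (fl x))) :
    Tendsto (fun n => ⨍ y in s, f n y) atTop (𝓝 (⨍ y in s, fl y)) := by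
  simp only [setAverage_eq]
  refine Tendsto.const_smul ?_ _
  exact tendsto_integral_of_dominated_convergence (fun _ => (1 : ℝ))
    (fun n => (hf n).aestronglyMeasurable) (integrableOn_const hs)
    (fun n => Eventually.of_forall fun x => hbd n x) (Eventually.of_forall hconv)

/-- **Stub `stub_cutoffEnstrophyPoincare` (R4 of the r8 skeleton; statement and proof in the
module docstring).** -/
theorem stub_cutoffEnstrophyPoincare :
    ∃ c : ℝ, 0 < c ∧
      ∀ (f : ℕ → EuclideanSpace ℝ (Fin 3) → EuclideanSpace ℝ (Fin 3))
        (fl : EuclideanSpace ℝ (Fin 3) → EuclideanSpace ℝ (Fin 3)) (D : ℝ), 0 ≤ D →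
        (∀ n, ContDiff ℝ 1 (f n)) → ContDiff ℝ 1 fl → (∀ n x, ‖f n x‖ ≤ 1) →
        (∀ x, Tendsto (fun n => f n x) atTop (𝓝 (fl x))) →
        (∀ R : ℝ, 0 < R → ∀ᶠ n in atTop,
          (∫⁻ y in Metric.ball 0 R, ENNReal.ofReal (frobeniusNormSq (fderiv ℝ (f n) y))) ≤ ENNReal.ofReal D) →
        ∫⁻ y, ENNReal.ofReal (frobeniusNormSq (fderiv ℝ fl y)) ≤ ENNReal.ofReal (c * D) := by
  obtain ⟨C, hC0, hC⟩ := exists_norm_fderiv_cutoff_le (E := EuclideanSpace ℝ (Fin 3))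
  refine ⟨2 + 1728 * C ^ 2, by positivity, ?_⟩
  intro f fl D hD hf1 hfl hbd hconv hDloc
  set M : ℝ := (2 + 1728 * C ^ 2) * D with hM
  -- ### Step 1: the bound on every ball
  have hball : ∀ R : ℝ, 0 < R →
      ∫⁻ y in Metric.ball 0 R, ENNReal.ofReal (frobeniusNormSq (fderiv ℝ fl y)) ≤
        ENNReal.ofReal M := by
    intro R hR
    have h3R : (0 : ℝ) < 3 * R := by positivity
    obtain ⟨N, hN⟩ := eventually_atTop.1 (hDloc (3 * R) h3R)
    -- the averages over `B(0,3R)` of the tail fields and of the limit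
    set B : Set (EuclideanSpace ℝ (Fin 3)) := Metric.ball 0 (3 * R) with hB
    have hBtop : volume B < ∞ := measure_ball_lt_top
    set a : ℕ → EuclideanSpace ℝ (Fin 3) := fun k => ⨍ y in B, f (k + N) y with ha
    set al : EuclideanSpace ℝ (Fin 3) := ⨍ y in B, fl y with hal
    have ha1 : ∀ k, ‖a k‖ ≤ 1 := fun k =>
      cutoffEnstrophyPoincare_norm_setAverage_le hBtop zero_le_one (hbd (k + N))
    have hal_lim : Tendsto a atTop (𝓝 al) :=
      cutoffEnstrophyPoincare_tendsto_setAverage hBtop.ne (fun k => (hf1 (k + N)).continuous)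
        (fun k x => hbd (k + N) x) (fun x => (hconv x).comp (tendsto_add_atTop_nat N))
    have key := lintegral_frobeniusNormSq_fderiv_le_of_tendsto_of_bound (C := 2) (D := M.toNNReal)
      (f := fun k x => cutoff R x • (f (k + N) x - a k)) (fl := fun x => cutoff R x • (fl x - al))
      (fun k => (contDiff_cutoff R).smul ((hf1 (k + N)).sub contDiff_const))
      ((contDiff_cutoff R).smul (hfl.sub contDiff_const))
      (fun k x => by
        rw [norm_smul, Real.norm_of_nonneg (cutoff_nonneg R x)]
        have h2 : ‖f (k + N) x - a k‖ ≤ 2 :=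
          (norm_sub_le _ _).trans (by linarith [hbd (k + N) x, ha1 k])
        calc cutoff R x * ‖f (k + N) x - a k‖ ≤ 1 * 2 :=
            mul_le_mul (cutoff_le_one R x) h2 (norm_nonneg _) zero_le_one
          _ = 2 := one_mul 2)
      (fun x => (((hconv x).comp (tendsto_add_atTop_nat N)).sub hal_lim).const_smul (cutoff R x))
      (fun k => ?_)
    · calc ∫⁻ y in Metric.ball 0 R, ENNReal.ofReal (frobeniusNormSq (fderiv ℝ fl y))
          = ∫⁻ y in Metric.ball 0 R,
              ENNReal.ofReal (frobeniusNormSq (fderiv ℝ (fun x => cutoff R x • (fl x - al)) y)) :=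
            setLIntegral_congr_fun Metric.isOpen_ball.measurableSet fun y hy => by
              rw [cutoffEnstrophy_fderiv_smul_eq_of_mem_ball hR (fun x => fl x - al) hy,
                fderiv_sub_const]
        _ ≤ ∫⁻ y, ENNReal.ofReal
              (frobeniusNormSq (fderiv ℝ (fun x => cutoff R x • (fl x - al)) y)) :=
            setLIntegral_le_lintegral _ _
        _ ≤ (M.toNNReal : ℝ≥0∞) := key
        _ = ENNReal.ofReal M := rfl
    · -- the uniform enstrophy bound of the cut-off mean-corrected tail fields
      have hk := hN (k + N) (Nat.le_add_left N k)
      have hreal : 6 * (C / R) ^ 2 * (288 * R ^ 2) * D = 1728 * C ^ 2 * D := by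
        field_simp
        ring
      calc ∫⁻ x, ENNReal.ofReal
              (frobeniusNormSq (fderiv ℝ (fun x => cutoff R x • (f (k + N) x - a k)) x))
          ≤ (2 * ∫⁻ x in B,
                ENNReal.ofReal (frobeniusNormSq (fderiv ℝ (fun x => f (k + N) x - a k) x))) +
              ENNReal.ofReal (6 * (C / R) ^ 2) * ∫⁻ x in B, ‖f (k + N) x - a k‖ₑ ^ 2 :=
            cutoffEnstrophy_lintegral_fderiv_smul_le hR (hC R hR) ((hf1 (k + N)).sub contDiff_const)
        _ = (2 * ∫⁻ x in B, ENNReal.ofReal (frobeniusNormSq (fderiv ℝ (f (k + N)) x))) +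
              ENNReal.ofReal (6 * (C / R) ^ 2) * ∫⁻ x in B, ‖f (k + N) x - a k‖ₑ ^ 2 := by
            simp only [fderiv_sub_const]
        _ ≤ 2 * ENNReal.ofReal D +
              ENNReal.ofReal (6 * (C / R) ^ 2) * (ENNReal.ofReal (288 * R ^ 2) * ENNReal.ofReal D) := by
            refine add_le_add (mul_le_mul_right hk _) (mul_le_mul_right ?_ _)
            calc ∫⁻ x in B, ‖f (k + N) x - a k‖ₑ ^ 2
                ≤ ENNReal.ofReal (288 * R ^ 2) *
                    ∫⁻ x in B, ENNReal.ofReal (frobeniusNormSq (fderiv ℝ (f (k + N)) x)) :=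
                  cutoffEnstrophyPoincare_lintegral_sub_average_sq_le hR (hf1 (k + N))
              _ ≤ _ := mul_le_mul_right hk _
        _ = ENNReal.ofReal M := by
            rw [hM, add_mul, ENNReal.ofReal_add (by positivity) (by positivity),
              ENNReal.ofReal_mul zero_le_two, ENNReal.ofReal_ofNat, ← mul_assoc,
              ← ENNReal.ofReal_mul (by positivity), ← ENNReal.ofReal_mul (by positivity), hreal]
        _ = (M.toNNReal : ℝ≥0∞) := rfl
  -- ### Step 2: exhaustion `R → ∞`
  rw [cutoffEnstrophy_lintegral_eq_iSup_ball]
  exact iSup_le fun n => hball _ (by positivity)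

end Summit.NavierStokesRegularity.NavierStokesRegularity.Theorems.RecordZoomAncient.Birth

end
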